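import Literature.MathematicalPhysics.QuantumManyBody.BoseGasThermodynamicLimitRuelle
import Literature.MathematicalPhysics.QuantumManyBody.PeriodicBoseGasJastrow
import Summits.AtomisticToContinuum.BoseEinsteinCondensation.Theorems.BECInfDivCoherenceGridInfDivCoherenceFreeRegionMaximiser
import Summits.AtomisticToContinuum.BoseEinsteinCondensation.Theorems.BECInfDivCoherenceGridInfDivCoherenceFreeRegionLatticeRetraction
import Mathlib.Topology.Connected.PathConnected
import Mathlib.Analysis.Convex.PathConnected
import HarnessLib

/-!
# Crux `GridInfDivCoherence` (stmt-AtomisticToContinuum-9114), line `registered`: sub-goal (D2a) of the dilute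
# hard-sphere connectivity statement — single-particle relocation on the lattice

The free region of `N` hard spheres with exclusion distance `b` on the torus `ℝ³/Lℤ³`, written on `(ℝ³)^N` with all
lattice images, is `F = {X | ∀ i ≠ j, ∀ n ∈ ℤ³, b < ‖X i - X j - L n‖}`. Write `s = L/M` (`M ≥ 1`) and assume
`2bM < L`, i.e. `2b < s`. We show (`freeRegion_lattice_relocate`, the registered signature): in a configuration `T`
on the lattice `sℤ³` all of whose image pair distances are `≥ s`, one particle `i` may be moved inside `F`, the others
staying put, from `p = T i` to any lattice point `q ∈ sℤ³` all of whose `Lℤ³`-images are at distance `≥ s` from the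
other particles: `T` is joined in `F` to `Function.update T i q`.

Proof (namespace `FreeRegionRelocate`; no auxiliary definitions). Moving only particle `i` along a path `γ` in `ℝ³`
keeps the configuration in `F` as soon as `γ` stays in the *mover region*
`S = {z | ∀ j ≠ i, ∀ n, b < ‖z - T j - L n‖}` (the static pairs keep their distances `≥ s > b`; the pair `(j, i)` is
the pair `(i, j)` with the opposite image), and `z ↦ update T i z` is continuous (`joinedIn_update`). Two kinds of
straight segments lie in `S`:
* the closed ball of radius `s/2` about a point `c` all of whose images of the other particles are `≥ s` away lies in
  `S` (triangle inequality: `≥ s - s/2 = s/2 > b`), so `c` is joined in `S` to every point of this ball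
  (`joinedIn_of_mem_closedBall`); this applies to `c = p` and to `c = q`;
* a segment whose endpoints share a coordinate `x_k = y_k ∈ s(ℤ + 1/2)` lies in `S`: every point `z` of it has the
  same `k`-th coordinate, every image `T j + L n` (`L = sM`, `T j ∈ sℤ³`) is a point of `sℤ³`, so
  `|z_k - (T j + L n)_k| = s·|d + 1/2| ≥ s/2 > b` for an integer `d`, and a coordinate is bounded by the norm
  (`joinedIn_of_apply_eq`).
The route is `p → p + (s/2)e₀` (ball about `p`), then three segments of the second kind through the channels of the
dual lattice, `(p₀ + s/2, p₁, p₂) → (p₀ + s/2, q₁ + s/2, q₂) → (q₀ + s/2, q₁ + s/2, q₂) → (q₀ + s/2, q₁, q₂)` (fixed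
half-integer coordinate `k = 0, 1, 0` respectively), then `q + (s/2)e₀ → q` (ball about `q`), composed with
`JoinedIn.trans`. For `N = 1` there are no other particles and the same formulae apply.

References: folklore (motion planning in configuration spaces of hard spheres, e.g. Baryshnikov–Bubenik–Kahle,
IMRN 2014, §2); Mathlib's `JoinedIn.of_segment_subset`, `convex_closedBall`, `JoinedIn.map`, `Continuous.update`,
`PiLp.norm_single`; the tree's `abs_apply_le_norm` (`PeriodicBoseGasJastrow.lean`), `latticeVec_apply/_neg`
(`PeriodicBoseGasLemma32.lean`).
-/

noncomputable section

namespace Summit.AtomisticToContinuum.BoseEinsteinCondensation.Theorems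

open Filter Literature.MathematicalPhysics.QuantumManyBody Literature.MathematicalPhysics.QuantumManyBody.BoseGas

namespace FreeRegionRelocate

variable {N : ℕ} {L : ℝ}

/-! ### Half-integers are at distance `≥ 1/2` from the integers -/

/-- `|d + 1/2| ≥ 1/2` for every integer `d`. [folklore] -/
theorem half_le_abs_intCast_add_half (d : ℤ) : (1 : ℝ) / 2 ≤ |(d : ℝ) + 1 / 2| := by
  rcases le_or_gt 0 d with h | h
  · have h' : (0 : ℝ) ≤ d := by exact_mod_cast h
    rw [abs_of_nonneg (by linarith)]
    linarith
  · have h' : (d : ℝ) ≤ -1 := by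
      have : d ≤ -1 := by omega
      exact_mod_cast this
    rw [abs_of_neg (by linarith)]
    linarith

/-- `|s d + s/2| ≥ s/2` for every integer `d` and `s ≥ 0`: a point of `s(ℤ + 1/2)` is at distance `≥ s/2` from
`0`, hence (by translation) from every point of `sℤ`. [folklore] -/
theorem half_le_abs_mul_intCast_add_half {s : ℝ} (hs : 0 ≤ s) (d : ℤ) : s / 2 ≤ |s * d + s / 2| := by
  have h : s * d + s / 2 = s * ((d : ℝ) + 1 / 2) := by ring
  rw [h, abs_mul, abs_of_nonneg hs]
  calc s / 2 = s * (1 / 2) := by ring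
    _ ≤ s * |(d : ℝ) + 1 / 2| := mul_le_mul_of_nonneg_left (half_le_abs_intCast_add_half d) hs

/-! ### Moving one particle: the mover region -/

/-- **Moving one particle.** If particle `i` travels along a path in the mover region
`S = {z | ∀ j ≠ i, ∀ n, b < ‖z - T j - L n‖}` while the other particles of `T` stay put, and the static pairs of `T`
are admissible, then the two end configurations are joined inside the free region: `z ↦ update T i z` is continuous
and maps `S` into the free region (the pair `(j, i)` is the pair `(i, j)` with the opposite image). [folklore] -/
theorem joinedIn_update {b : ℝ} {T : Config N} {i : Fin N}
    (hT : ∀ j j' : Fin N, j ≠ j' → ∀ n : Fin 3 → ℤ, b < ‖T j - T j' - latticeVec L n‖) {x y : Space}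
    (h : JoinedIn {z : Space | ∀ j : Fin N, j ≠ i → ∀ n : Fin 3 → ℤ, b < ‖z - T j - latticeVec L n‖} x y) :
    JoinedIn {X : Config N | ∀ i j : Fin N, i ≠ j → ∀ n : Fin 3 → ℤ, b < ‖X i - X j - latticeVec L n‖}
      (Function.update T i x) (Function.update T i y) := by
  have hc : Continuous fun z : Space => Function.update T i z := continuous_const.update i continuous_id
  refine (h.map hc).mono (Set.image_subset_iff.2 fun z hz => ?_)
  show ∀ a c : Fin N, a ≠ c → ∀ n : Fin 3 → ℤ,
    b < ‖Function.update T i z a - Function.update T i z c - latticeVec L n‖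
  intro a c hac n
  by_cases ha : a = i
  · rw [ha] at hac ⊢
    rw [Function.update_self, Function.update_of_ne hac.symm]
    exact hz c hac.symm n
  · rw [Function.update_of_ne ha]
    by_cases hc' : c = i
    · rw [hc', Function.update_self]
      have key : T a - z - latticeVec L n = -(z - T a - latticeVec L (-n)) := by
        rw [latticeVec_neg]; abel
      rw [key, norm_neg]
      exact hz a ha (-n)
    · rw [Function.update_of_ne hc']
      exact hT a c hac n

/-- The closed ball of radius `s/2` about a point `c`, all of whose images of the particles `j ≠ i` are at distance
`≥ s`, lies in the mover region of exclusion distance `b < s/2` (triangle inequality). [folklore] -/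
theorem closedBall_subset_moverRegion {b s : ℝ} {T : Config N} {i : Fin N} (hbs : 2 * b < s) {c : Space}
    (hc : ∀ j : Fin N, j ≠ i → ∀ n : Fin 3 → ℤ, s ≤ ‖c - T j - latticeVec L n‖) :
    Metric.closedBall c (s / 2) ⊆
      {z : Space | ∀ j : Fin N, j ≠ i → ∀ n : Fin 3 → ℤ, b < ‖z - T j - latticeVec L n‖} := by
  intro z hz j hj n
  rw [Metric.mem_closedBall, dist_eq_norm] at hz
  have key : c - T j - latticeVec L n = (z - T j - latticeVec L n) - (z - c) := by abel
  have h1 := norm_sub_le (z - T j - latticeVec L n) (z - c)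
  rw [← key] at h1
  linarith [hc j hj n]

/-- Hence such a point `c` is joined, inside the mover region, to every point of the closed ball of radius `s/2`
about it (along the segment, the ball being convex). [folklore] -/
theorem joinedIn_of_mem_closedBall {b s : ℝ} {T : Config N} {i : Fin N} (hbs : 2 * b < s) {c x : Space}
    (hc : ∀ j : Fin N, j ≠ i → ∀ n : Fin 3 → ℤ, s ≤ ‖c - T j - latticeVec L n‖)
    (hx : x ∈ Metric.closedBall c (s / 2)) :
    JoinedIn {z : Space | ∀ j : Fin N, j ≠ i → ∀ n : Fin 3 → ℤ, b < ‖z - T j - latticeVec L n‖} c x :=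
  (JoinedIn.of_segment_subset
    ((convex_closedBall c (s / 2)).segment_subset
      (Metric.mem_closedBall_self (Metric.nonempty_closedBall.1 ⟨x, hx⟩)) hx)).mono
    (closedBall_subset_moverRegion hbs hc)

/-- **The channels of the dual lattice.** If the particles `j ≠ i` sit on the lattice `sℤ³` and `L = sM`, then a
segment whose endpoints share a `k`-th coordinate in `s(ℤ + 1/2)` lies in the mover region of exclusion distance
`b < s/2`: along it the `k`-th coordinate is constant, and it differs from the `k`-th coordinate of every image
`T j + L n ∈ sℤ³` by at least `s/2 > b`. [folklore] -/
theorem segment_subset_moverRegion_of_apply_eq {M : ℕ} {b s : ℝ} {T : Config N} {i : Fin N} (hs : 0 ≤ s)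
    (hbs : 2 * b < s) (hL : L = s * M) (hT : ∀ j : Fin N, j ≠ i → ∃ z : Fin 3 → ℤ, T j = latticeVec s z)
    {x y : Space} {k : Fin 3} {m : ℤ} (hx : x k = s * m + s / 2) (hy : y k = x k) :
    segment ℝ x y ⊆ {z : Space | ∀ j : Fin N, j ≠ i → ∀ n : Fin 3 → ℤ, b < ‖z - T j - latticeVec L n‖} := by
  rintro z ⟨a, c, -, -, hac, rfl⟩ j hj n
  obtain ⟨w, hw⟩ := hT j hj
  have hzk : (a • x + c • y) k = s * m + s / 2 := by
    rw [PiLp.add_apply, PiLp.smul_apply, PiLp.smul_apply, smul_eq_mul, smul_eq_mul, hy, hx]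
    calc a * (s * m + s / 2) + c * (s * m + s / 2) = (a + c) * (s * m + s / 2) := by ring
      _ = s * m + s / 2 := by rw [hac, one_mul]
  have hcoord : (a • x + c • y - T j - latticeVec L n) k = s * ((m - w k - M * n k : ℤ) : ℝ) + s / 2 := by
    rw [PiLp.sub_apply, PiLp.sub_apply, hzk, hw, latticeVec_apply, latticeVec_apply, hL]
    push_cast
    ring
  have h1 := half_le_abs_mul_intCast_add_half hs (m - w k - M * n k)
  rw [← hcoord] at h1
  have h2 := abs_apply_le_norm (a • x + c • y - T j - latticeVec L n) k
  linarith

/-- Hence two points sharing a `k`-th coordinate in `s(ℤ + 1/2)` are joined inside the mover region (particles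
`j ≠ i` on `sℤ³`, `L = sM`, `2b < s`). [folklore] -/
theorem joinedIn_of_apply_eq {M : ℕ} {b s : ℝ} {T : Config N} {i : Fin N} (hs : 0 ≤ s) (hbs : 2 * b < s)
    (hL : L = s * M) (hT : ∀ j : Fin N, j ≠ i → ∃ z : Fin 3 → ℤ, T j = latticeVec s z)
    {x y : Space} {k : Fin 3} {m : ℤ} (hx : x k = s * m + s / 2) (hy : y k = x k) :
    JoinedIn {z : Space | ∀ j : Fin N, j ≠ i → ∀ n : Fin 3 → ℤ, b < ‖z - T j - latticeVec L n‖} x y :=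
  JoinedIn.of_segment_subset (segment_subset_moverRegion_of_apply_eq hs hbs hL hT hx hy)

end FreeRegionRelocate

/-- **Sub-goal (D2a) of the dilute hard-sphere connectivity statement G** (crux `GridInfDivCoherence`, line
`registered`), single-particle relocation on the lattice: on the torus `ℝ³/Lℤ³` with `2bM < L`, in a configuration
`T` on the lattice `(L/M)ℤ³` all of whose image pair distances are `≥ L/M`, any one particle `i` can be moved inside
the hard-sphere free region `F = {X | ∀ i ≠ j, ∀ n ∈ ℤ³, b < ‖X i - X j - L n‖}`, the others staying put, to any
lattice point `q` all of whose images are at distance `≥ L/M` from the other particles — out of its site into the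
ball of radius `L/(2M)`, through the channels of the dual lattice (segments at a fixed half-integer coordinate), and
into the target site. [folklore] -/
theorem freeRegion_lattice_relocate :
    ∀ (N M : ℕ) (L b : ℝ), 0 < M → 0 < b → 2 * b * M < L →
      ∀ T : Config N, (∀ i, ∃ z : Fin 3 → ℤ, T i = latticeVec (L / M) z) →
        (∀ i j : Fin N, i ≠ j → ∀ n : Fin 3 → ℤ, L / M ≤ ‖T i - T j - latticeVec L n‖) →
        ∀ (i : Fin N) (q : Space), (∃ z : Fin 3 → ℤ, q = latticeVec (L / M) z) →
          (∀ j : Fin N, j ≠ i → ∀ n : Fin 3 → ℤ, L / M ≤ ‖q - T j - latticeVec L n‖) →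
          JoinedIn {X : Config N | ∀ i j : Fin N, i ≠ j → ∀ n : Fin 3 → ℤ, b < ‖X i - X j - latticeVec L n‖}
            T (Function.update T i q) := by
  intro N M L b hM hb hbML T hT hTsep i q hq hqsep
  have hMpos : (0 : ℝ) < M := by exact_mod_cast hM
  set s : ℝ := L / M with hs_def
  have hbs : 2 * b < s := by
    rw [hs_def, lt_div_iff₀ hMpos]
    exact hbML
  have hs : 0 < s := by linarith
  have hL : L = s * M := by rw [hs_def, div_mul_cancel₀ L hMpos.ne']
  obtain ⟨zp, hzp⟩ := hT i
  obtain ⟨zq, hzq⟩ := hq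
  have hT' : ∀ j : Fin N, j ≠ i → ∃ z : Fin 3 → ℤ, T j = latticeVec s z := fun j _ => hT j
  -- the static pairs are admissible
  have hTb : ∀ j j' : Fin N, j ≠ j' → ∀ n : Fin 3 → ℤ, b < ‖T j - T j' - latticeVec L n‖ :=
    fun j j' hjj' n => by linarith [hTsep j j' hjj' n]
  -- the corners of the route
  obtain ⟨A₁, hA₁⟩ : ∃ A₁ : Space, A₁ = T i + EuclideanSpace.single 0 (s / 2) := ⟨_, rfl⟩
  obtain ⟨X₁, hX₁⟩ : ∃ X₁ : Space, X₁ = !₂[T i 0 + s / 2, q 1 + s / 2, q 2] := ⟨_, rfl⟩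
  obtain ⟨X₂, hX₂⟩ : ∃ X₂ : Space, X₂ = !₂[q 0 + s / 2, q 1 + s / 2, q 2] := ⟨_, rfl⟩
  obtain ⟨A₂, hA₂⟩ : ∃ A₂ : Space, A₂ = q + EuclideanSpace.single 0 (s / 2) := ⟨_, rfl⟩
  have hp0 : T i 0 = s * zp 0 := by rw [hzp, latticeVec_apply]
  have hq0 : q 0 = s * zq 0 := by rw [hzq, latticeVec_apply]
  have hq1 : q 1 = s * zq 1 := by rw [hzq, latticeVec_apply]
  have hA₁0 : A₁ 0 = s * zp 0 + s / 2 := by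
    rw [hA₁, PiLp.add_apply, PiLp.single_eq_same, hp0]
  have hX₁0 : X₁ 0 = A₁ 0 := by
    rw [hA₁0, hX₁, ← hp0]
    simp
  have hX₁1 : X₁ 1 = s * zq 1 + s / 2 := by
    rw [hX₁, ← hq1]
    simp
  have hX₂1 : X₂ 1 = X₁ 1 := by
    rw [hX₁1, hX₂, ← hq1]
    simp
  have hX₂0 : X₂ 0 = s * zq 0 + s / 2 := by
    rw [hX₂, ← hq0]
    simp
  have hA₂0 : A₂ 0 = X₂ 0 := by
    rw [hX₂0, hA₂, PiLp.add_apply, PiLp.single_eq_same, hq0]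
  have hball : ∀ c : Space, c + EuclideanSpace.single 0 (s / 2) ∈ Metric.closedBall c (s / 2) := by
    intro c
    rw [Metric.mem_closedBall, dist_eq_norm, add_sub_cancel_left, PiLp.norm_single, Real.norm_eq_abs,
      abs_of_pos (by positivity)]
  -- the five legs
  have hA₁mem : A₁ ∈ Metric.closedBall (T i) (s / 2) := by rw [hA₁]; exact hball (T i)
  have hA₂mem : A₂ ∈ Metric.closedBall q (s / 2) := by rw [hA₂]; exact hball q
  have h₁ := FreeRegionRelocate.joinedIn_of_mem_closedBall (b := b) hbs
    (fun j (hj : j ≠ i) n => hTsep i j hj.symm n) hA₁mem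
  have h₂ := FreeRegionRelocate.joinedIn_of_apply_eq hs.le hbs hL hT' hA₁0 hX₁0
  have h₃ := FreeRegionRelocate.joinedIn_of_apply_eq hs.le hbs hL hT' hX₁1 hX₂1
  have h₄ := FreeRegionRelocate.joinedIn_of_apply_eq hs.le hbs hL hT' hX₂0 hA₂0
  have h₅ := (FreeRegionRelocate.joinedIn_of_mem_closedBall (b := b) hbs hqsep hA₂mem).symm
  have key := FreeRegionRelocate.joinedIn_update hTb (h₁.trans (h₂.trans (h₃.trans (h₄.trans h₅))))
  rwa [Function.update_eq_self] at key

end Summit.AtomisticToContinuum.BoseEinsteinCondensation.Theorems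

end
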